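import Summits.QuantumFields.YangMills.Theorems.LuscherReductionRunningReductionValleyAxial
import HarnessLib

/-!
# COARSE-UPPER(L) with TWO polynomial scales: `δ = β^{−p}` (orbit-distance cut) and `η = β^{−q}` (action cut), `0 < p, q < 1/3` independently
# (glue of S-BASE's near-vacuum core, crux `TwistedTraceScaling` stmt-QuantumFields-20203; design `pub/ym-fleet/ym-luscher-20007-p1/COARSE-DESIGN.md` §13 (γ3))

The valley's zero-point perturbation theory (§13 (γ)) wants the action scale `η` much SMALLER than the orbit-distance scale `δ` (`η ≪ δ²`, i.e. `q > 2p`),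
while the glue `coarseNoIntruderAt_of_axial_pow` (`…ValleyAxial`) was stated with `δ = η`.  Since the onion error `onionErr L β δ η` is antitone in both
scales (`onionErr_anti`), admissibility of `(β^{−p}, β^{−q})` follows from that of the equal-exponent pair at `max p q` (`scalesAdmissible_powScale₂`), and
the whole chain re-runs verbatim: ★ `coarseNoIntruderAt_of_valley_oneOrbit_pow₂`, ★★ `coarseNoIntruderAt_of_axial_pow₂ :
0<p<1/3 → q<1/3 → ValleyRowBoundAt L (powScale p) (powScale q) → InnerNoIntruderAxialAt L (powScale p) → ⟨VERBATIM CoarseNoIntruderAt L⟩`.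
Recommended: `(p, q) = (1/8, 3/10)`.

HONEST FRAMING: real-exponent bookkeeping; femto rung R2b1 (glue for a stub of a child of a CONDITIONAL route); not a gap, not Clay.
-/

set_option autoImplicit false

noncomputable section

open Real
open Literature.MathematicalPhysics.QuantumFieldTheory
open Literature.MathematicalPhysics.QuantumLattice

namespace Summit.QuantumFields.YangMills.Theorems.FemtoTransferGap

variable {L : ℕ} [NeZero L]

/-- ★ **The onion error is antitone in both scales** (`β ≥ 0`): larger cut-off scales give a smaller IMS/large-field error.
[cite: SimonB1983DiscreteSpectrum, §3] -/
theorem onionErr_anti {β δ δ' η η' : ℝ} (hβ : 0 ≤ β) (hδ' : 0 < δ') (hδ : δ' ≤ δ) (hη' : 0 < η') (hη : η' ≤ η) :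
    onionErr L β δ η ≤ onionErr L β δ' η' := by
  unfold onionErr
  have hδ0 : 0 < δ := hδ'.trans_le hδ
  have hη0 : 0 < η := hη'.trans_le hη
  have h1 : Real.exp (-(β * η)) ≤ Real.exp (-(β * η')) := Real.exp_le_exp.mpr (by nlinarith)
  have h2 : (8 * π / δ) ^ 2 ≤ (8 * π / δ') ^ 2 := by
    apply pow_le_pow_left₀ (by positivity)
    exact div_le_div_of_nonneg_left (by positivity) hδ' hδ
  have h3 : (4 * π * Fintype.card (Plaquette 3 L) / η) ^ 2 ≤ (4 * π * Fintype.card (Plaquette 3 L) / η') ^ 2 := by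
    apply pow_le_pow_left₀ (by positivity)
    exact div_le_div_of_nonneg_left (by positivity) hη' hη
  have h4 : (0 : ℝ) ≤ 1 / 2 * ((Fintype.card (Edge 3 L) : ℝ) ^ 2 * (3 / β)) := by positivity
  nlinarith [mul_le_mul_of_nonneg_left (add_le_add h2 h3) h4]

omit [NeZero L] in
/-- `p ≤ r ⇒ β^{−r} ≤ β^{−p}` for the polynomial scales (`max β 1 ≥ 1`). [folklore] -/
theorem powScale_le_powScale {p r : ℝ} (hpr : p ≤ r) (β : ℝ) : powScale r β ≤ powScale p β := by
  unfold powScale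
  exact Real.rpow_le_rpow_of_exponent_le (le_max_right _ _) (by linarith)

/-- ★ **Two-exponent admissibility**: `0 < p < 1/3`, `q < 1/3` ⇒ `ScalesAdmissible L (powScale p) (powScale q)` (`q ≤ 0` is allowed but useless). [folklore] -/
theorem scalesAdmissible_powScale₂ {p q : ℝ} (hp0 : 0 < p) (hp : p < 1 / 3) (hq : q < 1 / 3) :
    ScalesAdmissible L (powScale p) (powScale q) := by
  refine ⟨fun β => powScale_pos p β, fun β => powScale_pos q β, fun κ hκ => ?_⟩
  have hr0 : 0 < max p q := lt_max_of_lt_left hp0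
  have hr : max p q < 1 / 3 := max_lt hp hq
  obtain ⟨β0, hβ0⟩ := (scalesAdmissible_powScale (L := L) hr0 hr).2.2 κ hκ
  refine ⟨max β0 0, fun β hβ => ?_⟩
  have hβ' : β0 ≤ β := (le_max_left _ _).trans hβ
  have hβ0' : 0 ≤ β := (le_max_right _ _).trans hβ
  exact (onionErr_anti hβ0' (powScale_pos _ β) (powScale_le_powScale (le_max_left p q) β) (powScale_pos _ β)
    (powScale_le_powScale (le_max_right p q) β)).trans (hβ0 β hβ')

/-- ★ **COARSE-UPPER(L) from VALLEY GAIN at `(β^{−p}, β^{−q})` and one-orbit INNER NO-INTRUDER at `β^{−p}`** (conclusion = VERBATIM the body of KTR's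
`CoarseNoIntruderAt L`). [cite: Luscher1983, §3] [cite: LuscherMunster1984, §2] -/
theorem coarseNoIntruderAt_of_valley_oneOrbit_pow₂ {p q : ℝ} (hp0 : 0 < p) (hp : p < 1 / 3) (hq : q < 1 / 3)
    (hV : ValleyGainAt L (powScale p) (powScale q)) (hI : InnerNoIntruderOneOrbitAt L (powScale p)) :
    ∀ k : ℕ, ∀ d : ℝ, d < levelGap k → ∃ lam0 : ℝ, 0 < lam0 ∧ ∀ lam : ℝ, 0 < lam → lam ≤ lam0 →
      ∀ β : ℝ, InFemtoWindow lam β L →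
        levelValue su2Rep L β k ≤ Real.exp (-(d * luscherLambda β L) / L) * levelValue su2Rep L β 0 := by
  have hL : (0 : ℝ) < L := by exact_mod_cast Nat.pos_of_ne_zero (NeZero.ne L)
  exact coarseNoIntruderAt_of_valley_inner (scalesAdmissible_powScale₂ hp0 hp hq) hV
    (innerNoIntruderAt_of_oneOrbit (fun β => powScale_pos p β) (powScale_eventually_le hp0 (by positivity)) hI)

/-- ★★ **COARSE-UPPER(L) from the AXIAL targets at two scales**: `ValleyRowBoundAt L (β^{−p}) (β^{−q}) → InnerNoIntruderAxialAt L (β^{−p}) →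
COARSE-UPPER(L)`, any `0 < p < 1/3`, `q < 1/3`. [cite: Luscher1983, §3] [cite: LuscherMunster1984, §2] -/
theorem coarseNoIntruderAt_of_axial_pow₂ {p q : ℝ} (hp0 : 0 < p) (hp : p < 1 / 3) (hq : q < 1 / 3)
    (hV : ValleyRowBoundAt L (powScale p) (powScale q)) (hI : InnerNoIntruderAxialAt L (powScale p)) :
    ∀ k : ℕ, ∀ d : ℝ, d < levelGap k → ∃ lam0 : ℝ, 0 < lam0 ∧ ∀ lam : ℝ, 0 < lam → lam ≤ lam0 →
      ∀ β : ℝ, InFemtoWindow lam β L →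
        levelValue su2Rep L β k ≤ Real.exp (-(d * luscherLambda β L) / L) * levelValue su2Rep L β 0 :=
  coarseNoIntruderAt_of_valley_oneOrbit_pow₂ hp0 hp hq (valleyGainAt_of_rowBound hV) (innerNoIntruderOneOrbitAt_of_axial hI)

/-- The recommended pair `(p, q) = (1/8, 3/10)` (`2p < q < 1/3`, design §13 (γ3)) is admissible. [folklore] -/
theorem scalesAdmissible_eighth_threeTenths : ScalesAdmissible L (powScale (1 / 8)) (powScale (3 / 10)) :=
  scalesAdmissible_powScale₂ (by norm_num) (by norm_num) (by norm_num)

end Summit.QuantumFields.YangMills.Theorems.FemtoTransferGap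

end
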